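import Summits.Parity.GeneralizedHardyLittlewood.Theses.GreenTaoLevelTwo
import HarnessLib

/-!
# Route `GreenTaoLevelTwo` — assembly item `Assembly` (stmt-Parity-21279)

`HeisMetricExists → GITwo → MNTwo → SharpTwo → MainTheoremLeFour`: the Green–Tao 2010 Main Theorem for every
non-degenerate finite-complexity system of `t ≤ 4` affine-linear forms, from the explicit Heisenberg-class
metric, the `U³[N]` inverse theorem `GITwo`, Möbius–nilsequence orthogonality `MNTwo` and the sharp estimate
`SharpTwo`.  The by-name closing file: the four route items are by definition the Literature statements of
`Literature/NumberTheory/Sieve/LinearEquationsInPrimesLevelTwoInputs.lean`, whose LANDED theorem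
`Literature.NumberTheory.Sieve.GreenTao2010_mainTheorem_of_le_four_of_inputs` is exactly this implication.
Honesty label (ROUND-6 §0): formalisation-first of printed theorems; FRONTIER rung F-GT2; no summit motion.
-/

namespace Summit.Parity.GeneralizedHardyLittlewood.Theorems

/-- **`Assembly` holds** (route `GreenTaoLevelTwo`, assembly stmt-Parity-21279):
`HeisMetricExists → GITwo → MNTwo → SharpTwo → GreenTaoLevelTwo.MainTheoremLeFour`.
Proof: the Literature assembly `GreenTao2010_mainTheorem_of_le_four_of_inputs` (GT2010 Thm 7.2 ⇒ Main Theorem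
at `s = 2`, relative inverse theorem Prop 10.1 and the transference of §§10–12 proved in the tree). -/
theorem greenTaoLevelTwo_assembly_proof :
    Summit.Parity.GeneralizedHardyLittlewood.Theses.GreenTaoLevelTwo.Assembly := by
  unfold Summit.Parity.GeneralizedHardyLittlewood.Theses.GreenTaoLevelTwo.Assembly
    Summit.Parity.GeneralizedHardyLittlewood.Theses.GreenTaoLevelTwo.HeisMetricExists
    Summit.Parity.GeneralizedHardyLittlewood.Theses.GreenTaoLevelTwo.GITwo
    Summit.Parity.GeneralizedHardyLittlewood.Theses.GreenTaoLevelTwo.MNTwo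
    Summit.Parity.GeneralizedHardyLittlewood.Theses.GreenTaoLevelTwo.SharpTwo
  intro h₀ h₁ h₂ h₃
  exact Literature.NumberTheory.Sieve.GreenTao2010_mainTheorem_of_le_four_of_inputs h₀ h₁ h₂ h₃

end Summit.Parity.GeneralizedHardyLittlewood.Theorems
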